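import Literature.IUT.HodgeArakelov.MonoThetaFromGroupsProofsTate
import Literature.IUT.HodgeArakelov.ModelDef11OutputOfOrigin
import Literature.IUT.HodgeArakelov.ModelReconstructionInvarianceTate
import Literature.AnabelianGeometry.EtaleTheta.SettingModelChiGroupLevelHolds
import Literature.AnabelianGeometry.EtaleTheta.SettingModelChiTheta
import HarnessLib

/-!
# [IUTchII] §1 bridge B8 at the Tate curve OF THE RECORD MODEL `ThetaSetting.modelχ p`: Def. 1.1 output,
# Prop. 1.2 (i), (ii) with the indeterminacy clause, and the Cor. 1.10 naturality square — the origin clauses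
# `IsEtThOrigin`, `hYcl`, the cyclotome input `hZ` and temp-slimness of `Π^tp_X` are THEOREMS there (proof-only)

S. Mochizuki, *Inter-universal Teichmüller theory II*, kurims manuscript (Dec. 2020), §1: Def. 1.1 (i), (ii)
pp. 20–21, Prop. 1.2 (i), (ii) pp. 25–26, Cor. 1.10 p. 47 [claim: Mochizuki2012, status: disputed]
  (IUTchII §1 Prop 1.2 (i), kurims p.25); S. Mochizuki, *The étale theta function …*, Publ. RIMS **45** (2009)
[EtTh],
§1 p. 12, Cor. 2.18 (iii)/(iv) pp. 61–63, Cor. 2.19 (i) p. 64 (PRIMS PDF pages)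
[cite: MochizukiEtTh2009, Cor 2.18(iv) p.61];
[SemiAnbd] Ex. 3.10 p. 45 [cite: MochizukiSemiAnbd2006, Ex 3.10 p.45].  Cell `abc-iut`, block F, seat abc-iut-f-150
  (gen 2); PROOF-ONLY: no definition, no instance, no new named fact; every input consumed BY NAME.

STATE OF RECORD.  Bridge B8 (abc-iut-L6-d6 `ModelDef11Output*`, `ModelReconstructionInvarianceTate`; abc-iut-w4-d008
`MonoThetaFromGroupsProofsTate`) proves, for the Tate curve `X̲̲_K` of ANY [EtTh] §1 theta setting `D` (the
[IUTchII] §1 setting `ofDoubleUnderline C μ hC hS hl hp2 hpl hζ hη` over abc-iut-L2-t8's rigidity data): the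
Def. 1.1 output and the Prop. 1.2 (i)/(ii) outputs `M^Θ(Π)`, `M^Θ(𝒞)` EXIST and carry the printed isomorphism
indeterminacy («`1` resp. `2` `μ_N`-conjugacy classes»), and the Cor. 1.10 naturality square of the cyclotomic
rigidity isomorphism holds — modulo Prop. 1.5 (iii), the cusp labels, the printed side conditions (`l` prime,
`p ≠ 2`, `p ≠ l`, `ζ_{4l} ∈ K`), a theta cocycle `η`, and the §1 origin clauses `IsEtThOrigin`, `hYcl`
  (through
which abc-iut-L2-d1's `ModelCyclotomes.nonempty_lDeltaQuot_rigidData_mulEquiv_zHat` supplies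
"`(l·Δ_Θ)/thetaKer ≅ Ẑ`"
and abc-iut-L2-t8's `rigidData_cor218_iv_fibre_of_origin` supplies Cor. 2.18 (iv)), plus — for the naturality
square — temp-slimness of `Π^tp_X` and [EtTh] Cor. 2.18 (i) (F-0620).

THIS FILE.  At the record model `D := ThetaSetting.modelχ p` (abc-iut-L2-t1; `Π^tp_X = Γ ⋊_χ G_{ℚ_p}`) the
clauses
`IsEtThOrigin` (`modelχ_isEtThOrigin`), `hYcl` (`hYcl_modelχ`) and `IsSlimGroup Π^tp_X` (abc-iut-w5-d111's
`isSlimGroup_piTemp_curveχ`) are THEOREMS; hence for every étale-theta datum `E` over `modelχ p`, every `X̲̲`,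
level `μ`, `hC`/`hS`/`h15`, labelling `L`, side conditions and theta cocycle: `nonempty_modelFrame_…_modelχ`
  (Def. 1.1 (i) frame), `nonempty_def11Output_…_modelχ` (Def. 1.1 output of EVERY mono-theta environment),
`nonempty_envOfGroup_…_modelχ` / `prop12_i_indeterminacy_envOfGroup_…_modelχ` /
`exists_envOfGroup_indeterminacy_…_modelχ`
  (Prop. 1.2 (i)), `exists_envOfFrobenioid_indeterminacy_…_modelχ` (Prop. 1.2 (ii)) — residual inputs `Prop15iii`,
`L`,
side conditions, `η` ONLY; and `exists_over_coe_cyclotomicRigidity_trans_mk_…_modelχ` (Cor. 1.10 naturality for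
EVERY automorphism of the model environment) — residual inputs `Prop15iii`, `L`, [EtTh] Cor. 2.18 (i) at level `μ`.
At `modelχ`, `K = ℚ_p`, so the side condition `ζ_{4l} ∈ K` restricts `p` to `p ≡ 1 (mod 4l)`.

HONEST LABEL: `modelχ` is a SEMI-SYNTHETIC model of the typed [EtTh] §1 interface (not the tempered `π₁` of a
curve): joint-satisfiability evidence for the origin / interface binders of bridge B8; the [IUTchII] claim key
`Mochizuki2012` is DISPUTED (D-0012), nothing of it asserted; nothing of [EtTh] / [SemiAnbd] asserted; no side is
taken on [IUTchIII] Cor. 3.12; typed ≠ proved.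
-/

noncomputable section

namespace Literature.IUT.HodgeArakelov

open Literature.AnabelianGeometry.EtaleTheta Literature.AnabelianGeometry.SemiGraphs
open Literature.AlgebraicGeometry.Frobenioids (IsSlimGroup)
open scoped Literature.AnabelianGeometry.EtaleTheta

namespace ThetaSetting

section TateModelChi

variable (p : ℕ) [Fact p.Prime]
  {E : (Literature.AnabelianGeometry.EtaleTheta.ThetaSetting.modelχ p).EtaleThetaData} {l : ℕ}
  (C : E.DoubleUnderline l) {N : ℕ+}
  (μ : (Literature.AnabelianGeometry.EtaleTheta.ThetaSetting.modelχ p).CyclotomeMod l N)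
  (hC : (Literature.AnabelianGeometry.EtaleTheta.ThetaSetting.modelχ p).Compat)
  (hS : (Literature.AnabelianGeometry.EtaleTheta.ThetaSetting.modelχ p).Sec2Hyps)

/-- **The Def. 1.1 (i) `ModelFrame` is inhabited for the Tate curve of the record model** — abc-iut-L6-d6's
`nonempty_modelFrame_ofDoubleUnderline` with `IsEtThOrigin`, `hYcl` SUPPLIED (`modelχ_isEtThOrigin`,
`hYcl_modelχ`);
residual: Prop. 1.5 (iii), the cusp labels, the side conditions, a theta cocycle.
[claim: Mochizuki2012, status: disputed] (IUTchII §1 Def 1.1 (i), kurims pp.20-21)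
[cite: MochizukiEtTh2009, §1 p.12] -/
theorem nonempty_modelFrame_ofDoubleUnderline_modelχ
    (h15 : Literature.AnabelianGeometry.EtaleTheta.ThetaSetting.Prop15iii E hC) (L : C.CuspLabels)
    (hl : l.Prime) (hp2 : p ≠ 2) (hpl : p ≠ l)
    (hζ : ∃ ζ : (Literature.AnabelianGeometry.EtaleTheta.ThetaSetting.modelχ p).K, IsPrimitiveRoot ζ (4 * l))
    {η : (C.thetaEnvData μ hC hS).PiYdd → MuN p N} (hη : η ∈ (C.thetaEnvData μ hC hS).thetaCocycles) :
Nonempty (ModelFrame (ofDoubleUnderline C μ hC hS hl hp2 hpl hζ hη) (C.rigidData μ hC hS h15 L)) :=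
nonempty_modelFrame_ofDoubleUnderline C μ hC hS h15 L hl hp2 hpl hζ hη
      (Literature.AnabelianGeometry.EtaleTheta.ThetaSetting.modelχ_isEtThOrigin p)
      (Literature.AnabelianGeometry.EtaleTheta.SettingModel.hYcl_modelχ p)

/-- **The [IUTchII] Def. 1.1 (i)+(ii) output EXISTS for every mono-theta environment of the Tate curve of the record
model** — abc-iut-L6-d6's `nonempty_def11Output_ofDoubleUnderline_of_origin` with `IsEtThOrigin`, `hYcl`
SUPPLIED
    (the cyclotome input "`(l·Δ_Θ)/thetaKer ≅ Ẑ`" being abc-iut-L2-d1's theorem at the origin `modelχ`).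
[claim: Mochizuki2012, status: disputed] (IUTchII §1 Def 1.1, kurims pp.20-21) [cite: MochizukiEtTh2009, §1 p.12] -/
theorem nonempty_def11Output_ofDoubleUnderline_modelχ
    (h15 : Literature.AnabelianGeometry.EtaleTheta.ThetaSetting.Prop15iii E hC) (L : C.CuspLabels)
    (hl : l.Prime) (hp2 : p ≠ 2) (hpl : p ≠ l)
    (hζ : ∃ ζ : (Literature.AnabelianGeometry.EtaleTheta.ThetaSetting.modelχ p).K, IsPrimitiveRoot ζ (4 * l))
    {η : (C.thetaEnvData μ hC hS).PiYdd → MuN p N} (hη : η ∈ (C.thetaEnvData μ hC hS).thetaCocycles)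
    (Mθ : MonoThetaEnv (ofDoubleUnderline C μ hC hS hl hp2 hpl hζ hη)) : Nonempty (Def11Output Mθ) :=
nonempty_def11Output_ofDoubleUnderline_of_origin C μ hC hS h15 L hl hp2 hpl hζ hη
      (Literature.AnabelianGeometry.EtaleTheta.ThetaSetting.modelχ_isEtThOrigin p)
      (Literature.AnabelianGeometry.EtaleTheta.SettingModel.hYcl_modelχ p) Mθ

/-- **The [IUTchII] Prop. 1.2 (i) output `Π ↦ M^Θ(Π)` EXISTS at the Tate curve of the record model**, for every
topological group `Π ≅ Π^tp_{X̲̲}` — abc-iut-L6-d6's `nonempty_envOfGroup_ofDoubleUnderline_of_origin` with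
`IsEtThOrigin`, `hYcl` SUPPLIED. [claim: Mochizuki2012, status: disputed] (IUTchII §1 Prop 1.2 (i), kurims p.25)
[cite: MochizukiEtTh2009, Cor 2.18(iv) p.61] -/
theorem nonempty_envOfGroup_ofDoubleUnderline_modelχ
    (h15 : Literature.AnabelianGeometry.EtaleTheta.ThetaSetting.Prop15iii E hC) (L : C.CuspLabels)
    (hl : l.Prime) (hp2 : p ≠ 2) (hpl : p ≠ l)
    (hζ : ∃ ζ : (Literature.AnabelianGeometry.EtaleTheta.ThetaSetting.modelχ p).K, IsPrimitiveRoot ζ (4 * l))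
    {η : (C.thetaEnvData μ hC hS).PiYdd → MuN p N} (hη : η ∈ (C.thetaEnvData μ hC hS).thetaCocycles)
    (P : TopGroup.{0}) (hP : Nonempty (P ≃ₜ* (ofDoubleUnderline C μ hC hS hl hp2 hpl hζ hη).PiX)) :
    Nonempty (EnvOfGroup (ofDoubleUnderline C μ hC hS hl hp2 hpl hζ hη) P) :=
nonempty_envOfGroup_ofDoubleUnderline_of_origin C μ hC hS h15 L hl hp2 hpl hζ hη
      (Literature.AnabelianGeometry.EtaleTheta.ThetaSetting.modelχ_isEtThOrigin p)
      (Literature.AnabelianGeometry.EtaleTheta.SettingModel.hYcl_modelχ p) P hP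

/-- **[IUTchII] Prop. 1.2 (i) indeterminacy clause at the Tate curve of the record model**: for every topological
group `Π ≅ Π^tp_{X̲̲}`, bridge B8 part 6's chosen `M^Θ(Π)` (its cyclotome input supplied at the origin
`modelχ`) has
the printed isomorphism indeterminacy — `1` (`N` odd) resp. `2` (`N` even) `μ_N`-conjugacy classes of automorphisms
over `Π_Y` — abc-iut-L6-d6's `prop12_i_indeterminacy_envOfGroup_ofDoubleUnderline_of_origin` with `IsEtThOrigin`,
`hYcl` SUPPLIED; residual: Prop. 1.5 (iii), cusp labels, side conditions, `η`.
[claim: Mochizuki2012, status: disputed] (IUTchII §1 Prop 1.2 (i), kurims p.25)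
[cite: MochizukiEtTh2009, Cor 2.18(iv) p.61] -/
theorem prop12_i_indeterminacy_envOfGroup_ofDoubleUnderline_modelχ
    (h15 : Literature.AnabelianGeometry.EtaleTheta.ThetaSetting.Prop15iii E hC) (L : C.CuspLabels)
    (hl : l.Prime) (hp2 : p ≠ 2) (hpl : p ≠ l)
    (hζ : ∃ ζ : (Literature.AnabelianGeometry.EtaleTheta.ThetaSetting.modelχ p).K, IsPrimitiveRoot ζ (4 * l))
    {η : (C.thetaEnvData μ hC hS).PiYdd → MuN p N} (hη : η ∈ (C.thetaEnvData μ hC hS).thetaCocycles)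
    (P : TopGroup.{0}) (hP : Nonempty (P ≃ₜ* (ofDoubleUnderline C μ hC hS hl hp2 hpl hζ hη).PiX)) :
    Prop12_i_indeterminacy
    (envOfGroup (C.rigidData μ hC hS h15 L) (SideData.ofDoubleUnderline C μ hC hS hl hp2 hpl hζ hη)
        (t1Space_Huu C) (isClosed_ker_aug_thetaEnvData C μ hC hS)
    (ModelCyclotomes.nonempty_lDeltaQuot_rigidData_mulEquiv_zHat C μ hC hS h15 L
            (Literature.AnabelianGeometry.EtaleTheta.ThetaSetting.modelχ_isEtThOrigin p)
            (Literature.AnabelianGeometry.EtaleTheta.SettingModel.hYcl_modelχ p) hl.ne_zero)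
        P hP).recon :=
prop12_i_indeterminacy_envOfGroup_ofDoubleUnderline_of_origin C μ hC hS h15 L hl hp2 hpl hζ hη
      (Literature.AnabelianGeometry.EtaleTheta.ThetaSetting.modelχ_isEtThOrigin p)
      (Literature.AnabelianGeometry.EtaleTheta.SettingModel.hYcl_modelχ p) P hP

/-- **Existence form of Prop. 1.2 (i) with its indeterminacy clause at the Tate curve of the record model**
    (abc-iut-w4-d008's `exists_envOfGroup_indeterminacy_ofDoubleUnderline` with `hZ`, `IsEtThOrigin`, `hYcl` SUPPLIED).
[claim: Mochizuki2012, status: disputed] (IUTchII §1 Prop 1.2 (i), kurims p.25)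
[cite: MochizukiEtTh2009, Cor 2.18(iv) p.61] -/
theorem exists_envOfGroup_indeterminacy_ofDoubleUnderline_modelχ
    (h15 : Literature.AnabelianGeometry.EtaleTheta.ThetaSetting.Prop15iii E hC) (L : C.CuspLabels)
    (hl : l.Prime) (hp2 : p ≠ 2) (hpl : p ≠ l)
    (hζ : ∃ ζ : (Literature.AnabelianGeometry.EtaleTheta.ThetaSetting.modelχ p).K, IsPrimitiveRoot ζ (4 * l))
    {η : (C.thetaEnvData μ hC hS).PiYdd → MuN p N} (hη : η ∈ (C.thetaEnvData μ hC hS).thetaCocycles)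
    (P : TopGroup.{0}) (hP : Nonempty (P ≃ₜ* (ofDoubleUnderline C μ hC hS hl hp2 hpl hζ hη).PiX)) :
∃ Env : EnvOfGroup (ofDoubleUnderline C μ hC hS hl hp2 hpl hζ hη) P, Prop12_i_indeterminacy
        Env.recon :=
exists_envOfGroup_indeterminacy_ofDoubleUnderline C μ hC hS h15 L hl hp2 hpl hζ hη
      (ModelCyclotomes.nonempty_lDeltaQuot_rigidData_mulEquiv_zHat C μ hC hS h15 L
      (Literature.AnabelianGeometry.EtaleTheta.ThetaSetting.modelχ_isEtThOrigin p)
      (Literature.AnabelianGeometry.EtaleTheta.SettingModel.hYcl_modelχ p) hl.ne_zero)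
      (Literature.AnabelianGeometry.EtaleTheta.ThetaSetting.modelχ_isEtThOrigin p)
      (Literature.AnabelianGeometry.EtaleTheta.SettingModel.hYcl_modelχ p) P hP

/-- **[IUTchII] Prop. 1.2 (ii) at the Tate curve of the record model**: for every tempered-Frobenioid datum `Fr` over
the [IUTchII] §1 setting and every mono-theta environment `Mθ` of it, an `EnvOfFrobenioid Fr` with
`M^Θ(𝒞) = Mθ`
whose Def. 1.1 (i) output has the Prop. 1.2 (i) indeterminacy — abc-iut-w4-d008's
`exists_envOfFrobenioid_indeterminacy_ofDoubleUnderline` with `hZ`, `IsEtThOrigin`, `hYcl` SUPPLIED.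
[claim: Mochizuki2012, status: disputed] (IUTchII §1 Prop 1.2 (ii), kurims pp.25-26)
[cite: MochizukiEtTh2009, Cor 2.18(iv) p.61] -/
theorem exists_envOfFrobenioid_indeterminacy_ofDoubleUnderline_modelχ
    (h15 : Literature.AnabelianGeometry.EtaleTheta.ThetaSetting.Prop15iii E hC) (L : C.CuspLabels)
    (hl : l.Prime) (hp2 : p ≠ 2) (hpl : p ≠ l)
    (hζ : ∃ ζ : (Literature.AnabelianGeometry.EtaleTheta.ThetaSetting.modelχ p).K, IsPrimitiveRoot ζ (4 * l))
    {η : (C.thetaEnvData μ hC hS).PiYdd → MuN p N} (hη : η ∈ (C.thetaEnvData μ hC hS).thetaCocycles)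
    (Fr : TemperedFrobenioidData (ofDoubleUnderline C μ hC hS hl hp2 hpl hζ hη))
    (Mθ : MonoThetaEnv (ofDoubleUnderline C μ hC hS hl hp2 hpl hζ hη)) :
    ∃ Env : EnvOfFrobenioid Fr, Env.env = Mθ ∧ Prop12_i_indeterminacy Env.recon :=
exists_envOfFrobenioid_indeterminacy_ofDoubleUnderline C μ hC hS h15 L hl hp2 hpl hζ hη
      (ModelCyclotomes.nonempty_lDeltaQuot_rigidData_mulEquiv_zHat C μ hC hS h15 L
      (Literature.AnabelianGeometry.EtaleTheta.ThetaSetting.modelχ_isEtThOrigin p)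
      (Literature.AnabelianGeometry.EtaleTheta.SettingModel.hYcl_modelχ p) hl.ne_zero)
      (Literature.AnabelianGeometry.EtaleTheta.ThetaSetting.modelχ_isEtThOrigin p)
      (Literature.AnabelianGeometry.EtaleTheta.SettingModel.hYcl_modelχ p) Fr Mθ

/-- **[IUTchII] Cor. 1.10 naturality square for EVERY automorphism of the Tate-curve model mono-theta environment,
at the record model** (`iso_{e ≫ α}[γ g] = iso_e[g]` in `Π_M`, the automorphism `γ` of `Π^tp_{X̲̲}`
supplied by
[EtTh] Cor. 2.18 (iii)): abc-iut-L6-d6's `exists_over_coe_cyclotomicRigidity_trans_mk_ofDoubleUnderline` with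
temp-slimness of `Π^tp_X` (`isSlimGroup_piTemp_curveχ`), `IsEtThOrigin`, `hYcl` SUPPLIED — residual inputs:
Prop. 1.5 (iii), the cusp labels, [EtTh] Cor. 2.18 (i) at level `μ` (F-0620, anabelian input), side conditions, `η`.
[claim: Mochizuki2012, status: disputed] (IUTchII §1 Cor 1.10, kurims p.47)
[cite: MochizukiEtTh2009, Cor 2.19(i) p.64] -/
theorem exists_over_coe_cyclotomicRigidity_trans_mk_ofDoubleUnderline_modelχ
    (h15 : Literature.AnabelianGeometry.EtaleTheta.ThetaSetting.Prop15iii E hC) (L : C.CuspLabels)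
    (hl : l.Prime) (hp2 : p ≠ 2) (hpl : p ≠ l)
    (hζ : ∃ ζ : (Literature.AnabelianGeometry.EtaleTheta.ThetaSetting.modelχ p).K, IsPrimitiveRoot ζ (4 * l))
    {η : (C.thetaEnvData μ hC hS).PiYdd → MuN p N} (hη : η ∈ (C.thetaEnvData μ hC hS).thetaCocycles)
    (h218i : (C.rigidData μ hC hS h15 L).Cor218_i)
    (F : ModelFrame (ofDoubleUnderline C μ hC hS hl hp2 hpl hζ hη) (C.rigidData μ hC hS h15 L))
    {Mθ : MonoThetaEnv (ofDoubleUnderline C μ hC hS hl hp2 hpl hζ hη)}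
    (e : Mθ.Pi ≃ₜ* (C.rigidData μ hC hS h15 L).env)
    {η' : (C.rigidData μ hC hS h15 L).PiYdd → (C.rigidData μ hC hS h15 L).mu}
    (hη' : η' ∈ (C.rigidData μ hC hS h15 L).thetaCocycles)
    (α : ((C.rigidData μ hC hS h15 L).modelMono hη').Iso ((C.rigidData μ hC hS h15 L).modelMono hη')) :
    ∃ (γ : (C.rigidData μ hC hS h15 L).PiX ≃ₜ* (C.rigidData μ hC hS h15 L).PiX)
    (hL : ∀ g : (C.rigidData μ hC hS h15 L).lDeltaTheta, γ g ∈ (C.rigidData μ hC hS h15 L).lDeltaTheta),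
    (∀ x, ((CycEnvelope.proj (C.rigidData μ hC hS h15 L).augY (C.rigidData μ hC hS h15 L).chi (α.e x) :
          (C.rigidData μ hC hS h15 L).PiY) : (C.rigidData μ hC hS h15 L).PiX) =
        γ ((CycEnvelope.proj (C.rigidData μ hC hS h15 L).augY (C.rigidData μ hC hS h15 L).chi x :
          (C.rigidData μ hC hS h15 L).PiY) : (C.rigidData μ hC hS h15 L).PiX)) ∧
      ∀ g : (C.rigidData μ hC hS h15 L).lDeltaTheta,
        ((F.cyclotomicRigidity (e.trans α.e)).iso
            (((ModelCyclotomes.intCycEquiv (C.rigidData μ hC hS h15 L)).symm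
                ((⟨γ g, hL g⟩ : (C.rigidData μ hC hS h15 L).lDeltaTheta) :
                  ModelCyclotomes.lDeltaQuot (C.rigidData μ hC hS h15 L)) :
                (ModelCyclotomes.intCyc (C.rigidData μ hC hS h15 L)).carrier) :
              ModPow (ModelCyclotomes.intCyc (C.rigidData μ hC hS h15 L)).carrier
                ((ofDoubleUnderline C μ hC hS hl hp2 hpl hζ hη).N : ℕ)) : Mθ.Pi) =
          ((F.cyclotomicRigidity e).iso
            (((ModelCyclotomes.intCycEquiv (C.rigidData μ hC hS h15 L)).symm
                (g : ModelCyclotomes.lDeltaQuot (C.rigidData μ hC hS h15 L)) :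
                (ModelCyclotomes.intCyc (C.rigidData μ hC hS h15 L)).carrier) :
              ModPow (ModelCyclotomes.intCyc (C.rigidData μ hC hS h15 L)).carrier
                ((ofDoubleUnderline C μ hC hS hl hp2 hpl hζ hη).N : ℕ)) : Mθ.Pi) :=
  exists_over_coe_cyclotomicRigidity_trans_mk_ofDoubleUnderline C μ hC hS h15 L hl hp2 hpl hζ hη
    (Literature.AnabelianGeometry.EtaleTheta.SettingModel.isSlimGroup_piTemp_curveχ p) h218i
        (Literature.AnabelianGeometry.EtaleTheta.ThetaSetting.modelχ_isEtThOrigin p)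
        (Literature.AnabelianGeometry.EtaleTheta.SettingModel.hYcl_modelχ p) F e hη' α

end TateModelChi

end ThetaSetting

end Literature.IUT.HodgeArakelov

end
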